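import Literature.Barriers.BirchSwinnertonDyer.RankNotSumOfLocalInvariantsDescentNeg1
import HarnessLib

/-!
# `rk E(F₄)` for `E = 480a1`, IX: the twist `E^{(-41)}` has rank `≤ 1` over `ℚ` (complete `2`-descent)

One of the six Selmer-sharp upper bounds to which the descent leaf `rk E(F₄) = 6` of
Dokchitser–Dokchitser 2011 (proof of Thm. 2, `E = 480a1`) is reduced in
`RankNotSumOfLocalInvariantsF4TwistsQ.lean` (hypothesis `hUm41`):

* `mordellWeilRank_twist_neg41_le_one : (curve480a1.quadraticTwist (-41)).mordellWeilRank ≤ 1`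

for `E^{(-41)} : y² = x³ + 41x² - 10086x = x (x - 82)(x + 123)`. Same method as
`RankNotSumOfLocalInvariantsDescentNeg1.lean` (which see): the coordinates character
`ψ = (sign, v₂, v₃, v₅, v_41)` of the two descent components `δ = (x, x - 82)` into `𝔽₂¹⁰` has
kernel in `2E(ℚ)` and image in the `8`-element solution set of the eight linear local conditions
at `∞, 2, 3, 5` (`signBit_eq_of_neg`; `dyadic_conditions_of_mod_eight_eq_seven` with `d = -41`;
`local_conditions_of_mult` at `3` and at `5`; the residue characters in coordinates by
`char_sqClass_eq_sum` with the values at `41`); counting (`mordellWeilRank_le_of_range_subset`,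
Mordell–Weil) gives `2^{r+2} ≤ 8`. Together with the point of infinite order of
`RankNotSumOfLocalInvariantsF4TwistPoints.lean` the rank is exactly `1`.

## References

* T. Dokchitser, V. Dokchitser, *A note on the Mordell–Weil rank modulo `n`*, J. Number Theory
  131 (2011) 1833–1839, arXiv:0910.4588, proof of Thm. 2. [DokchitserDokchitser2011RankModN]
* J. H. Silverman, *The Arithmetic of Elliptic Curves*, 2nd ed., GTM 106 (2009), Prop. X.1.4,
  Example X.1.5, Thm. VIII.6.7. [SilvermanAEC2009]
-/

noncomputable section

open scoped Classical

open WeierstrassCurve WeierstrassCurve.Affine WeierstrassCurve.Affine.Point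

namespace Literature.Barriers.BirchSwinnertonDyer

namespace DokchitserDokchitser2011

open Literature.NumberTheory.EllipticCurves
open Literature.NumberTheory.EllipticCurves.KramerTwoDescent
open Literature.NumberTheory.EllipticCurves.TwoDescentLocal

/-! ### Residue characters in coordinates for `{2, 3, 5, 41}`-supported classes -/

/-- The primes `{2, 3, 5, 41}`. [folklore] -/
theorem primes_235_41 : ∀ q ∈ ({2, 3, 5, 41} : Finset ℕ), q.Prime := by decide

/-- `chi4` in coordinates: `chi4 z = sign + v₃` (`chi4 41 = 0`). [folklore] -/
theorem chi4_eq_of_support_41 {z : ℚ} (hz : z ≠ 0)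
    (h : ∀ q : ℕ, q.Prime → q ∉ ({2, 3, 5, 41} : Finset ℕ) → Even (padicValRat q z)) :
    chi4 z = signBit z + parityBit 3 z := by
  have key := char_eq_sum_values chi4Hom chi4 (fun a ha => chi4Hom_sqClass ha) _ primes_235_41 hz h
  obtain ⟨h1, h2, h3, h5, h41, h73⟩ := chi4_values
  rw [key, Finset.sum_insert (by decide), Finset.sum_insert (by decide), Finset.sum_insert (by decide),
    Finset.sum_singleton]
  push_cast
  rw [h1, h2, h3, h5, h41]
  ring

/-- `chi8` in coordinates: `chi8 z = v₃ + v₅` (`chi8 41 = 0`). [folklore] -/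
theorem chi8_eq_of_support_41 {z : ℚ} (hz : z ≠ 0)
    (h : ∀ q : ℕ, q.Prime → q ∉ ({2, 3, 5, 41} : Finset ℕ) → Even (padicValRat q z)) :
    chi8 z = parityBit 3 z + parityBit 5 z := by
  have key := char_eq_sum_values chi8Hom chi8 (fun a ha => chi8Hom_sqClass ha) _ primes_235_41 hz h
  obtain ⟨h1, h2, h3, h5, h41, h73⟩ := chi8_values
  rw [key, Finset.sum_insert (by decide), Finset.sum_insert (by decide), Finset.sum_insert (by decide),
    Finset.sum_singleton]
  push_cast
  rw [h1, h2, h3, h5, h41]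
  ring

/-- `qrBit 3` in coordinates: `qrBit 3 z = sign + v₂ + v₅ + 1·v_41`. [folklore] -/
theorem qrBit_three_eq_of_support_41 {z : ℚ} (hz : z ≠ 0)
    (h : ∀ q : ℕ, q.Prime → q ∉ ({2, 3, 5, 41} : Finset ℕ) → Even (padicValRat q z)) :
    qrBit 3 z = signBit z + parityBit 2 z + parityBit 5 z + 1 * parityBit 41 z := by
  have key := char_eq_sum_values (qrHom 3) (qrBit 3) (fun a ha => qrHom_sqClass 3 ha) _
    primes_235_41 hz h
  obtain ⟨h1, h2, h3, h5, h41, h73⟩ := qrBit_three_values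
  rw [key, Finset.sum_insert (by decide), Finset.sum_insert (by decide), Finset.sum_insert (by decide),
    Finset.sum_singleton]
  push_cast
  rw [h1, h2, h3, h5, h41]
  ring

/-- `qrBit 5` in coordinates: `qrBit 5 z = v₂ + v₃ + 0·v_41`. [folklore] -/
theorem qrBit_five_eq_of_support_41 {z : ℚ} (hz : z ≠ 0)
    (h : ∀ q : ℕ, q.Prime → q ∉ ({2, 3, 5, 41} : Finset ℕ) → Even (padicValRat q z)) :
    qrBit 5 z = parityBit 2 z + parityBit 3 z + 0 * parityBit 41 z := by
  have key := char_eq_sum_values (qrHom 5) (qrBit 5) (fun a ha => qrHom_sqClass 5 ha) _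
    primes_235_41 hz h
  obtain ⟨h1, h2, h3, h5, h41, h73⟩ := qrBit_five_values
  rw [key, Finset.sum_insert (by decide), Finset.sum_insert (by decide), Finset.sum_insert (by decide),
    Finset.sum_singleton]
  push_cast
  rw [h1, h2, h3, h5, h41]
  ring

/-! ### The curve `E^{(-41)}` and its coordinates character -/

/-- The equation of `E^{(-41)}` in product form. [folklore] -/
theorem equation_neg41 {x y : ℚ} (hP : (curve480a1.quadraticTwist (-41)).toAffine.Nonsingular x y) :
    y ^ 2 = x * (x - 82) * (x + 123) := by
  have h := (twist_nonsingular_iff (by norm_num : (-41 : ℚ) ≠ 0) x y).mp hP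
  rw [h]; ring

/-- On `E^{(-41)}`, `y = 0` forces `x ∈ {0, 82, -123}`. [folklore] -/
theorem x_eq_of_y_eq_zero_neg41 {x : ℚ} (hP : (curve480a1.quadraticTwist (-41)).toAffine.Nonsingular x 0) :
    x = 0 ∨ x = 82 ∨ x = -123 := by
  have h := equation_neg41 hP
  rw [zero_pow two_ne_zero, zero_eq_mul, mul_eq_zero] at h
  rcases h with (h | h) | h
  · exact Or.inl h
  · exact Or.inr (Or.inl (by linarith))
  · exact Or.inr (Or.inr (by linarith))

/-- The coordinate space `𝔽₂⁵ × 𝔽₂⁵` of `(sign, v₂, v₃, v₅, v_41)` of the two components. [folklore] -/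
abbrev V10_41 : Type :=
  (ZMod 2 × ZMod 2 × ZMod 2 × ZMod 2 × ZMod 2) × (ZMod 2 × ZMod 2 × ZMod 2 × ZMod 2 × ZMod 2)

/-- The sign/parity coordinates `(sign, v₂, v₃, v₅, v_41)` of a rational. [folklore] -/
def coordOf41 (z : ℚ) : ZMod 2 × ZMod 2 × ZMod 2 × ZMod 2 × ZMod 2 :=
  (signBit z, parityBit 2 z, parityBit 3 z, parityBit 5 z, parityBit 41 z)

section Coords

variable [DecidableEq ℚ]

/-- **The coordinates character** of `E^{(-41)}(ℚ)`. [folklore] -/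
def ψDesc41 : GHom (curve480a1.quadraticTwist (-41)).toAffine.Point V10_41 :=
  ((charFst splitTwoTorsion_neg41 signHom).prod ((charFst splitTwoTorsion_neg41 (parityHom 2)).prod
    ((charFst splitTwoTorsion_neg41 (parityHom 3)).prod ((charFst splitTwoTorsion_neg41 (parityHom 5)).prod
      (charFst splitTwoTorsion_neg41 (parityHom 41)))))).prod
  ((charSnd splitTwoTorsion_neg41 signHom).prod ((charSnd splitTwoTorsion_neg41 (parityHom 2)).prod
    ((charSnd splitTwoTorsion_neg41 (parityHom 3)).prod ((charSnd splitTwoTorsion_neg41 (parityHom 5)).prod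
      (charSnd splitTwoTorsion_neg41 (parityHom 41))))))

/-- `ψ` on a point with `x ≠ 0, 82`. [folklore] -/
theorem ψDesc41_some {x y : ℚ} (hP : (curve480a1.quadraticTwist (-41)).toAffine.Nonsingular x y)
    (hx₁ : x ≠ 0) (hx₂ : x ≠ 82) : ψDesc41 (.some x y hP) = (coordOf41 x, coordOf41 (x - 82)) := by
  have hx₂' : x - 82 ≠ 0 := sub_ne_zero.mpr hx₂
  simp only [ψDesc41, AddMonoidHom.prod_apply, charFst_apply, charSnd_apply,
    twoDescentComponent_some_of_ne hP hx₁, twoDescentComponent_some_of_ne hP hx₂, sub_zero,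
    signHom_sqClass hx₁, parityHom_sqClass hx₁, signHom_sqClass hx₂', parityHom_sqClass hx₂', coordOf41]

/-- `ψ` at the points with `x = 0`. [folklore] -/
theorem ψDesc41_x0 {y : ℚ} (hP : (curve480a1.quadraticTwist (-41)).toAffine.Nonsingular 0 y) :
    ψDesc41 (.some _ _ hP) = (((1 : ZMod 2), (1 : ZMod 2), (1 : ZMod 2), (0 : ZMod 2), (0 : ZMod 2)),
      ((1 : ZMod 2), (1 : ZMod 2), (0 : ZMod 2), (0 : ZMod 2), (1 : ZMod 2))) := by
  have hx : ((0 : ℚ) - 82) * (0 - -123) ≠ 0 := by norm_num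
  have hx' : (0 : ℚ) - 82 ≠ 0 := by norm_num
  simp only [ψDesc41, AddMonoidHom.prod_apply, charFst_apply, charSnd_apply,
    twoDescentComponent_some_of_eq hP rfl,
    twoDescentComponent_some_of_ne hP (show (0 : ℚ) ≠ 82 by norm_num),
    signHom_sqClass hx, parityHom_sqClass hx, signHom_sqClass hx', parityHom_sqClass hx']
  refine Prod.ext (Prod.ext (signBit_of_neg (by norm_num)) (Prod.ext ?_ (Prod.ext ?_ (Prod.ext ?_ ?_))))
    (Prod.ext (signBit_of_neg (by norm_num)) (Prod.ext ?_ (Prod.ext ?_ (Prod.ext ?_ ?_))))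
  · exact parityBit_eq_of_eq 2 1 (u := 5043) (v := 1) (-1) (Or.inr rfl) (by norm_num) (by norm_num)
      (by norm_num)
  · exact parityBit_eq_of_eq 3 1 (u := 3362) (v := 1) (-1) (Or.inr rfl) (by norm_num) (by norm_num)
      (by norm_num)
  · exact parityBit_eq_of_eq 5 0 (u := 10086) (v := 1) (-1) (Or.inr rfl) (by norm_num) (by norm_num)
      (by norm_num)
  · exact parityBit_eq_of_eq 41 2 (u := 6) (v := 1) (-1) (Or.inr rfl) (by norm_num) (by norm_num)
      (by norm_num)
  · exact parityBit_eq_of_eq 2 1 (u := 41) (v := 1) (-1) (Or.inr rfl) (by norm_num) (by norm_num)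
      (by norm_num)
  · exact parityBit_eq_of_eq 3 0 (u := 82) (v := 1) (-1) (Or.inr rfl) (by norm_num) (by norm_num)
      (by norm_num)
  · exact parityBit_eq_of_eq 5 0 (u := 82) (v := 1) (-1) (Or.inr rfl) (by norm_num) (by norm_num)
      (by norm_num)
  · exact parityBit_eq_of_eq 41 1 (u := 2) (v := 1) (-1) (Or.inr rfl) (by norm_num) (by norm_num)
      (by norm_num)

/-- `ψ` at the points with `x = 82`. [folklore] -/
theorem ψDesc41_x1 {y : ℚ} (hP : (curve480a1.quadraticTwist (-41)).toAffine.Nonsingular 82 y) :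
    ψDesc41 (.some _ _ hP) = (((0 : ZMod 2), (1 : ZMod 2), (0 : ZMod 2), (0 : ZMod 2), (1 : ZMod 2)),
      ((0 : ZMod 2), (1 : ZMod 2), (0 : ZMod 2), (1 : ZMod 2), (0 : ZMod 2))) := by
  have hx : (82 : ℚ) - 0 ≠ 0 := by norm_num
  have hx' : ((82 : ℚ) - 0) * (82 - -123) ≠ 0 := by norm_num
  simp only [ψDesc41, AddMonoidHom.prod_apply, charFst_apply, charSnd_apply,
    twoDescentComponent_some_of_ne hP (show (82 : ℚ) ≠ 0 by norm_num),
    twoDescentComponent_some_of_eq hP rfl,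
    signHom_sqClass hx, parityHom_sqClass hx, signHom_sqClass hx', parityHom_sqClass hx']
  refine Prod.ext (Prod.ext (signBit_of_nonneg (by norm_num)) (Prod.ext ?_ (Prod.ext ?_ (Prod.ext ?_ ?_))))
    (Prod.ext (signBit_of_nonneg (by norm_num)) (Prod.ext ?_ (Prod.ext ?_ (Prod.ext ?_ ?_))))
  · exact parityBit_eq_of_eq 2 1 (u := 41) (v := 1) (1) (Or.inl rfl) (by norm_num) (by norm_num)
      (by norm_num)
  · exact parityBit_eq_of_eq 3 0 (u := 82) (v := 1) (1) (Or.inl rfl) (by norm_num) (by norm_num)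
      (by norm_num)
  · exact parityBit_eq_of_eq 5 0 (u := 82) (v := 1) (1) (Or.inl rfl) (by norm_num) (by norm_num)
      (by norm_num)
  · exact parityBit_eq_of_eq 41 1 (u := 2) (v := 1) (1) (Or.inl rfl) (by norm_num) (by norm_num)
      (by norm_num)
  · exact parityBit_eq_of_eq 2 1 (u := 8405) (v := 1) (1) (Or.inl rfl) (by norm_num) (by norm_num)
      (by norm_num)
  · exact parityBit_eq_of_eq 3 0 (u := 16810) (v := 1) (1) (Or.inl rfl) (by norm_num) (by norm_num)
      (by norm_num)
  · exact parityBit_eq_of_eq 5 1 (u := 3362) (v := 1) (1) (Or.inl rfl) (by norm_num) (by norm_num)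
      (by norm_num)
  · exact parityBit_eq_of_eq 41 2 (u := 10) (v := 1) (1) (Or.inl rfl) (by norm_num) (by norm_num)
      (by norm_num)

end Coords

/-- The eight linear local conditions on the coordinates (`∞`; `2` ×3; `3` ×2; `5` ×2). [folklore] -/
def CDesc41 (w : V10_41) : Prop :=
  w.1.1 = w.2.1 ∧ w.1.2.1 = w.2.2.1 ∧ w.1.1 + w.1.2.2.1 = 0 ∧
    w.2.2.2.1 + w.2.2.2.2.1 = w.1.2.2.1 + w.1.2.2.2.1 + w.1.2.1 ∧
    w.2.2.2.1 = 0 ∧ w.2.1 + w.2.2.1 + w.2.2.2.2.1 + w.2.2.2.2.2 = w.1.2.2.1 ∧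
    w.1.2.2.2.1 = 0 ∧ w.1.2.1 + w.1.2.2.1 = w.2.2.2.2.1

/-- `CDesc41` is decidable. [folklore] -/
instance decCDesc41 : DecidablePred CDesc41 := fun w => by
  unfold CDesc41; exact inferInstance

/-- The solution set `T`: `8` of the `1024` coordinate vectors. [folklore] -/
def TDesc41 : Finset V10_41 := Finset.univ.filter fun w => CDesc41 w

/-- `#T = 8`. [folklore] -/
theorem card_TDesc41 : TDesc41.card = 8 := by decide

/-- A prime different from two given primes does not divide their product. [folklore] -/
theorem padicValNat_mul_primes_41 {q a b : ℕ} [Fact q.Prime] [Fact a.Prime] [Fact b.Prime]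
    (ha : q ≠ a) (hb : q ≠ b) : padicValNat q (a * b) = 0 := by
  rw [padicValNat.mul (Fact.out : a.Prime).ne_zero (Fact.out : b.Prime).ne_zero,
    padicValNat_primes ha, padicValNat_primes hb]

/-- **The local conditions hold for every rational point of `E^{(-41)}` with `y ≠ 0`.**
[cite: SilvermanAEC2009, Prop. X.1.4] -/
theorem cDesc41_coordOf {x y : ℚ} (hP : (curve480a1.quadraticTwist (-41)).toAffine.Nonsingular x y)
    (hy : y ≠ 0) : CDesc41 (coordOf41 x, coordOf41 (x - 82)) := by
  have h := equation_neg41 hP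
  have h₀ : x * (x - 82) * (x + 123) ≠ 0 := h ▸ pow_ne_zero 2 hy
  have hx : x ≠ 0 := fun h0 => h₀ (by rw [h0, zero_mul, zero_mul])
  have hx₂ : x - 82 ≠ 0 := fun h0 => h₀ (by rw [h0, mul_zero, zero_mul])
  -- parities outside `{2, 3, 5, 41}`
  have hE₁ : y ^ 2 = (x - 0) * (x - 82) * (x - (-123)) := by rw [h]; ring
  have hE₂ : y ^ 2 = (x - 82) * (x - 0) * (x - (-123)) := by rw [h]; ring
  have P₁ : ∀ q : ℕ, q.Prime → q ∉ ({2, 3, 5, 41} : Finset ℕ) → Even (padicValRat q x) := by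
    intro q hq hqS
    haveI := Fact.mk hq
    simp only [Finset.mem_insert, Finset.mem_singleton, not_or] at hqS
    have := Curve24A1.even_padicValRat_sub q (by norm_num) (by norm_num) ?_ ?_ hy hE₁
    · rwa [sub_zero] at this
    · rw [show (0 : ℚ) - 82 = -((2 * 41 : ℕ) : ℚ) by norm_num, padicValRat.neg, padicValRat.of_nat,
        padicValNat_mul_primes_41 hqS.1 hqS.2.2.2, Nat.cast_zero]
    · rw [show (0 : ℚ) - (-123) = ((3 * 41 : ℕ) : ℚ) by norm_num, padicValRat.of_nat,
        padicValNat_mul_primes_41 hqS.2.1 hqS.2.2.2, Nat.cast_zero]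
  have P₂ : ∀ q : ℕ, q.Prime → q ∉ ({2, 3, 5, 41} : Finset ℕ) → Even (padicValRat q (x - 82)) := by
    intro q hq hqS
    haveI := Fact.mk hq
    simp only [Finset.mem_insert, Finset.mem_singleton, not_or] at hqS
    refine Curve24A1.even_padicValRat_sub q (by norm_num) (by norm_num) ?_ ?_ hy hE₂
    · rw [show (82 : ℚ) - 0 = ((2 * 41 : ℕ) : ℚ) by norm_num, padicValRat.of_nat,
        padicValNat_mul_primes_41 hqS.1 hqS.2.2.2, Nat.cast_zero]
    · rw [show (82 : ℚ) - (-123) = ((5 * 41 : ℕ) : ℚ) by norm_num, padicValRat.of_nat,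
        padicValNat_mul_primes_41 hqS.2.2.1 hqS.2.2.2, Nat.cast_zero]
  -- the residue characters in coordinates
  have c4 := chi4_eq_of_support_41 hx P₁
  have c8₁ := chi8_eq_of_support_41 hx P₁
  have c8₂ := chi8_eq_of_support_41 hx₂ P₂
  have q3₂ := qrBit_three_eq_of_support_41 hx₂ P₂
  have q5₁ := qrBit_five_eq_of_support_41 hx P₁
  -- the local conditions
  have hd : ((-41 : ℤ)) % 8 = 7 := by decide
  have hdy : y ^ 2 = x * (x + 2 * ((-41 : ℤ) : ℚ)) * (x - 3 * ((-41 : ℤ) : ℚ)) := by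
    rw [h]; push_cast; ring
  obtain ⟨d1, d2, d3⟩ := dyadic_conditions_of_mod_eight_eq_seven hd hy hdy
  have hsgn := signBit_eq_of_neg (show (-41 : ℤ) < 0 by decide) hy hdy
  have e2 : x + 2 * ((-41 : ℤ) : ℚ) = x - 82 := by push_cast; ring
  rw [e2] at d1 d3 hsgn
  -- at `3`, roles `e₁ = 82`, `e₂ = 0`, `e₃ = -123`
  have h3 := local_conditions_of_mult (p := 3) (e₁ := 82) (e₂ := 0) (e₃ := -123) (by decide) (by decide)
    (padicValRat_eq_of_eq 1 (u := 41) (v := 1) 1 (Or.inl rfl) (by norm_num) (by norm_num)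
      (by push_cast; norm_num)) hy (by rw [h]; push_cast; ring)
  -- at `5`, `e₁ = 0`, `e₂ = 82`, `e₃ = -123`
  have h5 := local_conditions_of_mult (p := 5) (e₁ := 0) (e₂ := 82) (e₃ := -123) (by decide) (by decide)
    (padicValRat_eq_of_eq 1 (u := 41) (v := 1) 1 (Or.inl rfl) (by norm_num) (by norm_num)
      (by push_cast; norm_num)) hy (by rw [h]; push_cast; ring)
  obtain ⟨h3a, h3b⟩ := h3
  obtain ⟨h5a, h5b⟩ := h5
  simp only [Int.cast_zero, Int.cast_ofNat, sub_zero] at h3a h3b h5a h5b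
  have q3c : qrBit 3 ((0 : ℚ) - 82) = 1 := by
    rw [show (0 : ℚ) - 82 = ((-82 : ℤ) : ℚ) by norm_num]
    exact qrBit_eq_one_of_not_isSquare (by
      rw [res_of_eq_zero 3 (padicValRat_intCast_eq_zero (by decide)), Rat.cast_intCast]
      exact fun ⟨r, hr⟩ => by fin_cases r <;> revert hr <;> decide)
  have q5c : qrBit 5 ((82 : ℚ)) = 1 := by
    rw [show (82 : ℚ) = ((82 : ℤ) : ℚ) by norm_num]
    exact qrBit_eq_one_of_not_isSquare (by
      rw [res_of_eq_zero 5 (padicValRat_intCast_eq_zero (by decide)), Rat.cast_intCast]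
      exact fun ⟨r, hr⟩ => by fin_cases r <;> revert hr <;> decide)
  rw [q3c] at h3b
  rw [q5c] at h5b
  have hb₂ : parityBit 3 (x - 82) = 0 := parityBit_eq_zero_iff.mpr h3a
  have hc₁ : parityBit 5 x = 0 := parityBit_eq_zero_iff.mpr h5a
  -- assemble
  simp only [CDesc41, coordOf41]
  refine ⟨hsgn, d1, ?_, ?_, hb₂, ?_, hc₁, ?_⟩
  · rw [← c4]; exact d2
  · rw [← c8₂, d3, c8₁]
  · have t := q3₂.symm.trans h3b
    linear_combination t
  · have t := q5₁.symm.trans h5b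
    linear_combination t

/-- **`E^{(-41)}` has Mordell–Weil rank `≤ 1` over `ℚ`** — the upper bound `hUm41` of
`descent_480a1_F4_of_upper_bounds`, by the complete `2`-descent with the coordinates character
`ψDesc41` (image in the `8`-element set `TDesc41`, kernel in `2E(ℚ)`) and
`mordellWeilRank_le_of_range_subset`. (With `one_le_mordellWeilRank_neg41`: rank exactly `1`.)
[cite: DokchitserDokchitser2011RankModN, proof of Thm. 2] -/
theorem mordellWeilRank_twist_neg41_le_one : (curve480a1.quadraticTwist (-41)).mordellWeilRank ≤ 1 := by
  letI : DecidableEq ℚ := fun a b => Classical.propDecidable (a = b)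
  have h := splitTwoTorsion_neg41
  set T₁ : (curve480a1.quadraticTwist (-41)).toAffine.Point := .some _ _ (nonsingular_twoTorsion h) with hT₁
  set T₂ : (curve480a1.quadraticTwist (-41)).toAffine.Point := .some _ _ (nonsingular_twoTorsion h.swap₁₂) with hT₂
  have hsub : ∀ P, ψDesc41 P ∈ TDesc41 := by
    intro P
    rw [TDesc41, Finset.mem_filter]
    refine ⟨Finset.mem_univ _, ?_⟩
    rcases P with _ | ⟨x, y, hP⟩
    · show CDesc41 (ψDesc41 0)
      rw [AddMonoidHom.map_zero]; decide
    · by_cases hx₁ : x = 0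
      · subst hx₁
        rw [ψDesc41_x0 hP]; decide
      by_cases hx₂ : x = 82
      · subst hx₂
        rw [ψDesc41_x1 hP]; decide
      by_cases hy : y = 0
      · subst hy
        rcases x_eq_of_y_eq_zero_neg41 hP with h0 | h2 | h3
        · exact absurd h0 hx₁
        · exact absurd h2 hx₂
        · subst h3
          rw [ψDesc41_some hP hx₁ hx₂]
          have e1 : coordOf41 (-123 : ℚ) = (1, 0, 1, 0, 1) := by
            simp only [coordOf41]
            refine Prod.ext (signBit_of_neg (show (-123 : ℚ) < 0 by norm_num)) (Prod.ext ?_ (Prod.ext ?_ (Prod.ext ?_ ?_)))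
            · exact parityBit_eq_of_eq 2 0 (u := 123) (v := 1) (-1) (Or.inr rfl) (by norm_num) (by norm_num)
                (by norm_num)
            · exact parityBit_eq_of_eq 3 1 (u := 41) (v := 1) (-1) (Or.inr rfl) (by norm_num) (by norm_num)
                (by norm_num)
            · exact parityBit_eq_of_eq 5 0 (u := 123) (v := 1) (-1) (Or.inr rfl) (by norm_num) (by norm_num)
                (by norm_num)
            · exact parityBit_eq_of_eq 41 1 (u := 3) (v := 1) (-1) (Or.inr rfl) (by norm_num) (by norm_num)
                (by norm_num)
          have e2 : coordOf41 ((-123 : ℚ) - 82) = (1, 0, 0, 1, 1) := by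
            simp only [coordOf41]
            refine Prod.ext (signBit_of_neg (show (-123 - 82 : ℚ) < 0 by norm_num)) (Prod.ext ?_ (Prod.ext ?_ (Prod.ext ?_ ?_)))
            · exact parityBit_eq_of_eq 2 0 (u := 205) (v := 1) (-1) (Or.inr rfl) (by norm_num) (by norm_num)
                (by norm_num)
            · exact parityBit_eq_of_eq 3 0 (u := 205) (v := 1) (-1) (Or.inr rfl) (by norm_num) (by norm_num)
                (by norm_num)
            · exact parityBit_eq_of_eq 5 1 (u := 41) (v := 1) (-1) (Or.inr rfl) (by norm_num) (by norm_num)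
                (by norm_num)
            · exact parityBit_eq_of_eq 41 1 (u := 5) (v := 1) (-1) (Or.inr rfl) (by norm_num) (by norm_num)
                (by norm_num)
          rw [e1, e2]; decide
      · rw [ψDesc41_some hP hx₁ hx₂]
        exact cDesc41_coordOf hP hy
  have hker : ∀ P, ψDesc41 P = 0 → ∃ Q, P = 2 • Q := by
    intro P hP0
    suffices hδ : twoDescentMap h P = 0 by
      have hmem : P ∈ (twoDescentMap h).ker := hδ
      rw [ker_twoDescentMap h] at hmem
      obtain ⟨Q, hQ⟩ := hmem
      exact ⟨Q, hQ.symm⟩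
    rcases P with _ | ⟨x, y, hP⟩
    · rfl
    · by_cases hx₁ : x = 0
      · exfalso; subst hx₁
        rw [ψDesc41_x0 hP] at hP0
        exact absurd hP0 (by decide)
      by_cases hx₂ : x = 82
      · exfalso; subst hx₂
        rw [ψDesc41_x1 hP] at hP0
        exact absurd hP0 (by decide)
      rw [ψDesc41_some hP hx₁ hx₂, Prod.mk_eq_zero] at hP0
      obtain ⟨h1, h2⟩ := hP0
      simp only [coordOf41, Prod.mk_eq_zero] at h1 h2
      have hy : y ≠ 0 := by
        rintro rfl
        rcases x_eq_of_y_eq_zero_neg41 hP with h0 | h0 | h0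
        · exact hx₁ h0
        · exact hx₂ h0
        · subst h0; exact absurd h1.1 (by rw [signBit_of_neg (by norm_num)]; decide)
      have hE₁ : y ^ 2 = (x - 0) * (x - 82) * (x - (-123)) := by rw [equation_neg41 hP]; ring
      have hE₂ : y ^ 2 = (x - 82) * (x - 0) * (x - (-123)) := by rw [equation_neg41 hP]; ring
      have hx₂' : x - 82 ≠ 0 := sub_ne_zero.mpr hx₂
      have ev₁ : ∀ q : ℕ, q.Prime → Even (padicValRat q x) := by
        intro q hq
        haveI := Fact.mk hq
        by_cases hq2 : q = 2; · subst hq2; exact parityBit_eq_zero_iff.mp h1.2.1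
        by_cases hq3 : q = 3; · subst hq3; exact parityBit_eq_zero_iff.mp h1.2.2.1
        by_cases hq5 : q = 5; · subst hq5; exact parityBit_eq_zero_iff.mp h1.2.2.2.1
        by_cases hqN : q = 41; · subst hqN; exact parityBit_eq_zero_iff.mp h1.2.2.2.2
        have := Curve24A1.even_padicValRat_sub q (by norm_num) (by norm_num) ?_ ?_ hy hE₁
        · rwa [sub_zero] at this
        · rw [show (0 : ℚ) - 82 = -((2 * 41 : ℕ) : ℚ) by norm_num, padicValRat.neg, padicValRat.of_nat,
            padicValNat_mul_primes_41 hq2 hqN, Nat.cast_zero]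
        · rw [show (0 : ℚ) - (-123) = ((3 * 41 : ℕ) : ℚ) by norm_num, padicValRat.of_nat,
            padicValNat_mul_primes_41 hq3 hqN, Nat.cast_zero]
      have ev₂ : ∀ q : ℕ, q.Prime → Even (padicValRat q (x - 82)) := by
        intro q hq
        haveI := Fact.mk hq
        by_cases hq2 : q = 2; · subst hq2; exact parityBit_eq_zero_iff.mp h2.2.1
        by_cases hq3 : q = 3; · subst hq3; exact parityBit_eq_zero_iff.mp h2.2.2.1
        by_cases hq5 : q = 5; · subst hq5; exact parityBit_eq_zero_iff.mp h2.2.2.2.1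
        by_cases hqN : q = 41; · subst hqN; exact parityBit_eq_zero_iff.mp h2.2.2.2.2
        refine Curve24A1.even_padicValRat_sub q (by norm_num) (by norm_num) ?_ ?_ hy hE₂
        · rw [show (82 : ℚ) - 0 = ((2 * 41 : ℕ) : ℚ) by norm_num, padicValRat.of_nat,
            padicValNat_mul_primes_41 hq2 hqN, Nat.cast_zero]
        · rw [show (82 : ℚ) - (-123) = ((5 * 41 : ℕ) : ℚ) by norm_num, padicValRat.of_nat,
            padicValNat_mul_primes_41 hq5 hqN, Nat.cast_zero]
      have hpos₁ : 0 < x := (signBit_eq_zero_iff hx₁).mp h1.1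
      have hpos₂ : 0 < x - 82 := (signBit_eq_zero_iff hx₂').mp h2.1
      rw [twoDescentMap_apply, twoDescentComponent_some_of_ne hP hx₁,
        twoDescentComponent_some_of_ne hP hx₂, sub_zero, sqClass_eq_one_of_forall hx₁ hpos₁ ev₁,
        sqClass_eq_one_of_forall hx₂' hpos₂ ev₂]
      rfl
  have hfin₁ : IsOfFinAddOrder T₁ := by
    refine isOfFinAddOrder_iff_nsmul_eq_zero.mpr ⟨2, two_pos, ?_⟩
    rw [two_nsmul, hT₁]
    exact add_self_of_Y_eq (by norm_num [negY, twoTorsionY])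
  have hfin₂ : IsOfFinAddOrder T₂ := by
    refine isOfFinAddOrder_iff_nsmul_eq_zero.mpr ⟨2, two_pos, ?_⟩
    rw [two_nsmul, hT₂]
    exact add_self_of_Y_eq (by norm_num [negY, twoTorsionY])
  have h₁ : ψDesc41 T₁ ≠ 0 := by rw [hT₁, ψDesc41_x0]; decide
  have h₂ : ψDesc41 T₂ ≠ 0 := by rw [hT₂, ψDesc41_x1]; decide
  have h₃ : ψDesc41 (T₁ + T₂) ≠ 0 := by rw [map_add, hT₁, hT₂, ψDesc41_x0, ψDesc41_x1]; decide
  have h₁₂ : ψDesc41 T₁ ≠ ψDesc41 T₂ := by rw [hT₁, hT₂, ψDesc41_x0, ψDesc41_x1]; decide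
  exact mordellWeilRank_le_of_range_subset (ψDesc41) hker hfin₁ hfin₂ h₁ h₂ h₃ h₁₂ (TDesc41) hsub
    (r := 1) (by rw [card_TDesc41]; norm_num)

end DokchitserDokchitser2011

end Literature.Barriers.BirchSwinnertonDyer

end
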